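import Summits.BirchSwinnertonDyer.BirchSwinnertonDyer.Theorems.ClassRecordThreeEulerHalvesAtThreeCartanTorusCubeCutFrame
import HarnessLib

/-!
# Crux 19109 `EulerHalvesAtThree` ∕ 23422 line `cartan` v8′, stub (F2a): the TORUS-CUBE CUT of S-K1′ — LEMMA Z (proved):
# the centre of `GL₂(𝔽_q)` acts trivially on every `CartanTorusLattice q`

Seat `bsd-idea-10` g11 (planner-bsd-idea-10-g11-0, D-0145 ideator; `--supports stmt-BirchSwinnertonDyer-19109 --as helper`). CONTENT (all PROVED, sorry-free):
`matrix_eq_one_of_pow_eq_one_of_trace` — a rational matrix `A` with `A^n = 1` (`n ≥ 1`) all of whose powers have trace `d` (= the size) is `1`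
(`S = Σ_{k<n} A^k` satisfies `A S = S`, `S² = n S`, `tr S = n d`; `1 − S/n` is an idempotent of trace `0`, hence `0` by Mathlib's
`LinearMap.IsIdempotentElem.eq_zero_of_trace_eq_zero`; so `S = n·1` and `A = 1`); `rho_eq_one_of_char_pow` — an element `z ∈ GL₂(𝔽_q)` all of
whose powers have character value `d` acts as `1` on a `CartanTorusLattice` (transport `ρ(z)` to a rational matrix via `LinearMap.toMatrix'` and
`trace_eq`); `cubicNewvectorCharMat_of_isScalarMat` — the character `cubicNewvectorCharMat` takes the value `χ(1)` on every scalar matrix;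
`char_one_eq_d` — `χ(1) = d`; and **LEMMA Z** `rho_eq_one_of_isScalarMat` — every scalar `z` acts trivially. This is the input "the centre `Z`
(`|Z| = q − 1`) acts trivially" of the principal-series inputs (P1), (P3) of the torus-cube cut (`…CartanTorusCubeCut`, card `Cruxes/EulerHalvesAtThree/
Lines/cartan_sk1.md`): it is why the full-torus norm coefficients carry the factor `3^{ord₃(q−1)}`.
HONEST FRAMING: linear algebra of one finite group acting on one lattice; nothing about any curve, `L`-value or period; S-K1′ is NOT proved; no summit
statement, no route item and no registered stub is proved; BSD is proved for no curve. [folklore]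
-/

namespace Summit.BirchSwinnertonDyer.BirchSwinnertonDyer.Theorems.CartanTorusCubeCut

open Summit.BirchSwinnertonDyer.BirchSwinnertonDyer.Theorems.CartanDegree

set_option linter.dupNamespace false
set_option linter.unusedSectionVars false
set_option autoImplicit false

variable {q : ℕ} [Fact q.Prime]

/-- A rational matrix of finite order all of whose powers have full trace is the identity. -/
theorem matrix_eq_one_of_pow_eq_one_of_trace {d n : ℕ} (hn : 0 < n) (A : Matrix (Fin d) (Fin d) ℚ)
    (hA : A ^ n = 1) (htr : ∀ k : ℕ, (A ^ k).trace = d) : A = 1 := by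
  set S : Matrix (Fin d) (Fin d) ℚ := ∑ k ∈ Finset.range n, A ^ k with hS
  have hAS : A * S = S := by
    have h1 := Finset.sum_range_succ' (fun k => A ^ k) n
    have h2 := Finset.sum_range_succ (fun k => A ^ k) n
    have h3 : ∑ k ∈ Finset.range n, A ^ (k + 1) + A ^ 0 = S + A ^ n := h1.symm.trans h2
    rw [pow_zero, hA] at h3
    have h4 : ∑ k ∈ Finset.range n, A ^ (k + 1) = S := add_right_cancel h3
    conv_rhs => rw [← h4]
    rw [hS, Finset.mul_sum]
    refine Finset.sum_congr rfl fun k _ => ?_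
    rw [pow_succ']
  have hkS : ∀ k : ℕ, A ^ k * S = S := by
    intro k
    induction k with
    | zero => rw [pow_zero, one_mul]
    | succ k ih => rw [pow_succ, mul_assoc, hAS, ih]
  have hSS : S * S = (n : ℚ) • S := by
    conv_lhs => rw [hS]
    rw [Finset.sum_mul]
    simp_rw [← hS, hkS]
    rw [Finset.sum_const, Finset.card_range, ← Nat.cast_smul_eq_nsmul ℚ]
  have htrS : S.trace = n * d := by
    rw [hS, Matrix.trace_sum]
    simp_rw [htr]
    rw [Finset.sum_const, Finset.card_range, nsmul_eq_mul]
  have hn' : (n : ℚ) ≠ 0 := by exact_mod_cast hn.ne'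
  set Q : Matrix (Fin d) (Fin d) ℚ := 1 - (n : ℚ)⁻¹ • S with hQ
  have hPP : ((n : ℚ)⁻¹ • S) * ((n : ℚ)⁻¹ • S) = (n : ℚ)⁻¹ • S := by
    rw [smul_mul_smul_comm, hSS, smul_smul]
    congr 1
    field_simp
  have hQQ : Q * Q = Q := by
    rw [hQ, sub_mul, one_mul, mul_sub, mul_one, hPP, sub_self, sub_zero]
  have htrQ : Q.trace = 0 := by
    rw [hQ, Matrix.trace_sub, Matrix.trace_one, Matrix.trace_smul, htrS, Fintype.card_fin, smul_eq_mul]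
    field_simp
    ring
  have he : IsIdempotentElem (Matrix.toLin' Q) := by
    change Matrix.toLin' Q * Matrix.toLin' Q = Matrix.toLin' Q
    rw [Module.End.mul_eq_comp, ← Matrix.toLin'_mul, hQQ]
  have hQ0 : Matrix.toLin' Q = 0 :=
    LinearMap.IsIdempotentElem.eq_zero_of_trace_eq_zero he (by rw [Matrix.trace_toLin'_eq, htrQ])
  have hQ0' : Q = 0 := by
    have := congrArg LinearMap.toMatrix' hQ0
    simpa using this
  -- so S = n • 1, and A * S = S gives A = 1
  have hS1 : S = (n : ℚ) • (1 : Matrix (Fin d) (Fin d) ℚ) := by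
    have : (n : ℚ)⁻¹ • S = 1 := by
      rw [hQ] at hQ0'
      exact (sub_eq_zero.1 hQ0').symm
    calc S = (n : ℚ) • ((n : ℚ)⁻¹ • S) := by rw [smul_smul, mul_inv_cancel₀ hn', one_smul]
      _ = (n : ℚ) • 1 := by rw [this]
  rw [hS1, Matrix.mul_smul, mul_one] at hAS
  exact smul_right_injective _ hn' hAS

/-- **Lemma Z**: an element `z` of `GL₂(𝔽_q)` of finite order all of whose powers have character value `d` (e.g. a central
element, on which `cubicNewvectorChar` takes the value `χ(1) = d`) acts trivially on a `CartanTorusLattice`. -/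
theorem rho_eq_one_of_char_pow (𝓛 : CartanTorusLattice q) (z : G q)
    (hz : ∀ k : ℕ, cubicNewvectorChar q (z ^ k) = 𝓛.d) : 𝓛.ρ z = 1 := by
  -- pass to rational matrices
  set A : Matrix (Fin 𝓛.d) (Fin 𝓛.d) ℤ := LinearMap.toMatrix' (𝓛.ρ z) with hA
  set Aq : Matrix (Fin 𝓛.d) (Fin 𝓛.d) ℚ := A.map (Int.castRingHom ℚ) with hAq
  have hpow : ∀ k : ℕ, LinearMap.toMatrix' (𝓛.ρ (z ^ k)) = A ^ k := by
    intro k; rw [map_pow, hA]; exact map_pow (LinearMap.toMatrixAlgEquiv' (R := ℤ) (n := Fin 𝓛.d)) _ k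
  have hAqpow : ∀ k : ℕ, Aq ^ k = (A ^ k).map (Int.castRingHom ℚ) := by
    intro k; rw [hAq]; exact (map_pow (Int.castRingHom ℚ).mapMatrix A k).symm
  have hord : Aq ^ (orderOf z) = 1 := by
    rw [hAqpow, ← hpow, pow_orderOf_eq_one, map_one, LinearMap.toMatrix'_one (R := ℤ)]
    exact (Int.castRingHom ℚ).mapMatrix.map_one
  have htr : ∀ k : ℕ, (Aq ^ k).trace = 𝓛.d := by
    intro k
    rw [hAqpow, ← hpow]
    have h1 : (LinearMap.toMatrix' (𝓛.ρ (z ^ k))).trace = LinearMap.trace ℤ _ (𝓛.ρ (z ^ k)) := by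
      rw [← Matrix.trace_toLin'_eq, Matrix.toLin'_toMatrix']
    have h2 : LinearMap.trace ℤ _ (𝓛.ρ (z ^ k)) = 𝓛.d := by rw [𝓛.trace_eq]; exact hz k
    have aux : ∀ M : Matrix (Fin 𝓛.d) (Fin 𝓛.d) ℤ,
        (M.map (Int.castRingHom ℚ)).trace = ((M.trace : ℤ) : ℚ) := by
      intro M; simp [Matrix.trace, Matrix.diag]
    rw [aux, h1, h2]
    simp
  have hAq1 : Aq = 1 :=
    matrix_eq_one_of_pow_eq_one_of_trace (orderOf_pos z) Aq hord htr
  have hA1 : A = 1 := by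
    have hinj : Function.Injective (fun M : Matrix (Fin 𝓛.d) (Fin 𝓛.d) ℤ => M.map (Int.castRingHom ℚ)) :=
      fun M N h => Matrix.ext fun i j => by
        have := congrFun (congrFun h i) j
        simpa [Matrix.map_apply] using this
    apply hinj
    simp only
    rw [← hAq, hAq1]
    exact ((Int.castRingHom ℚ).mapMatrix.map_one).symm
  have : LinearMap.toMatrix' (𝓛.ρ z) = LinearMap.toMatrix' (1 : Module.End ℤ (Fin 𝓛.d → ℤ)) := by
    rw [← hA, hA1, LinearMap.toMatrix'_one]
  exact LinearMap.toMatrix'.injective this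

/-- a scalar matrix is `a·1`. -/
theorem eq_smul_one_of_isScalarMat {M : Mat q} (h : IsScalarMat M) : M = M 0 0 • (1 : Mat q) := by
  obtain ⟨h01, h10, h00⟩ := h
  ext i j
  fin_cases i <;> fin_cases j <;> simp [h01, h10, h00]

/-- powers of a scalar matrix are scalar. -/
theorem isScalarMat_pow {M : Mat q} (h : IsScalarMat M) (k : ℕ) : IsScalarMat (M ^ k) := by
  rw [eq_smul_one_of_isScalarMat h, smul_pow, one_pow]
  refine ⟨?_, ?_, ?_⟩ <;> simp

/-- the character takes the same value on every scalar matrix (namely `χ(1) = q ± 1`). -/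
theorem cubicNewvectorCharMat_of_isScalarMat {M : Mat q} (h : IsScalarMat M) :
    cubicNewvectorCharMat q M = cubicNewvectorCharMat q 1 := by
  have h1 : IsScalarMat (1 : Mat q) := ⟨by simp, by simp, by simp⟩
  have hΔ : ∀ {N : Mat q}, IsScalarMat N → N.trace ^ 2 - 4 * N.det = 0 := by
    intro N hN
    obtain ⟨h01, h10, h00⟩ := hN
    rw [Matrix.trace_fin_two, Matrix.det_fin_two, h01, h00]
    ring
  simp only [cubicNewvectorCharMat, hΔ h, hΔ h1, h, h1, if_true]

/-- `χ(1) = d`: the rank of the lattice is the character value at the identity. -/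
theorem char_one_eq_d (𝓛 : CartanTorusLattice q) : cubicNewvectorChar q 1 = 𝓛.d := by
  rw [← 𝓛.trace_eq 1, map_one, LinearMap.trace_one, Module.finrank_fin_fun]

/-- **Lemma Z (the centre acts trivially)**: a scalar element of `GL₂(𝔽_q)` acts as the identity on every `CartanTorusLattice q`
(its powers are scalar, the character is `χ(1) = d` on scalars, and a finite-order integral matrix all of whose powers have full
trace is `1`). -/
theorem rho_eq_one_of_isScalarMat (𝓛 : CartanTorusLattice q) (z : G q) (hz : IsScalarMat (z : Mat q)) : 𝓛.ρ z = 1 := by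
  apply rho_eq_one_of_char_pow
  intro k
  rw [← char_one_eq_d 𝓛, cubicNewvectorChar, cubicNewvectorChar, Units.val_pow_eq_pow_val, Units.val_one]
  exact cubicNewvectorCharMat_of_isScalarMat (isScalarMat_pow hz k)

end Summit.BirchSwinnertonDyer.BirchSwinnertonDyer.Theorems.CartanTorusCubeCut
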